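import Summits.QuantumFields.YangMills.Theorems.BalabanUVNodesN15CovariantLandauTwoGridAdLetters
import Summits.QuantumFields.YangMills.Theorems.BalabanUVNodesN15CovariantLandauBlockMeanLipschitz
import Summits.QuantumFields.YangMills.Theorems.BalabanUVNodesN15CovariantLandauLeibnizRows
import HarnessLib

/-!
# Route «BalabanUVNodes», node N15 = NE2, road (c) — PROGRAMME (P-S), XLI: THE TWO-GRID OSCILLATION LETTER `ω_V` OF THE LATTICE DIVERGENCE `div_n(n(1 − T))` FROM (3.35) — the
# gradient word `n²(Ad_{e^{A(z)/n}} − Ad_{e^{A(z−e)/n}}) = ad_{∇A(z)} + O(r·ℓ)` and the GRADIENT FIT of King block means `|∇′A′ − (∇Ā)∘pr| ≤ (2(d+1)(L^m−1) + L^m)·ℓ₂′` (dag-n15-c g25, n15-c∕248)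

Cell `pub-ymgap`, seat `pub-ymgap-dag-n15-c` (generation g25; R134 (a), s1; HUMAN RULING D-0062; chair R424 venue).  `bears_on: R4∕N15 · K3⁸ SpineGivenEndpointR13SepCoPHV
(stmt-QuantumFields-27366)`; filed `--supports stmt-QuantumFields-27366 --as helper` — COUNT-NEUTRAL.  Theorems only; 0 `sorry`.  Imports BY NAME n15-c∕247 (`norm_scaledAdDiff_sub_comm_le`,
`smul_one_sub_cvT₀_exp_eq`-pattern), n15-c∕233a (`fibre_kingPrV_shift`, `norm_sub_smul_steps_le`), (V4) `fibre_conn_kingPrV`, n15-c∕224∕225 (`bDiv`).  Nothing in the tree is modified.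

WHY.  n15-c∕243's inputs `hωV`, `hωVt` are the rows ∕ columns of `div_{n′}(N′)(x′) − div_n(N)(pr x′)`, `N = n(1 − T)`, `T_μ(z) = coordMat e Ad_{e^{A_μ(z)/n}}`; since
`div_n N (z) = Σ_μ n²(T_μ(z) − T_μ(z − e_μ))` and `n²(Ad_{e^{B₁/n}} − Ad_{e^{B₂/n}}) = ad_{n(B₁ − B₂)} + O(r·|B₁ − B₂|)` (n15-c∕247), the two-grid difference is
`Σ_μ (ad_{∇′_μA′_μ(x′)} − ad_{∇_μĀ_μ(pr x′)}) + O((d+1)·r·(ℓ′ + ℓ))` with `ℓ′, ℓ = L^mℓ′` the unit-step sizes; and the GRADIENT FIT: the coarse gradient of the King block mean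
`n(Ā(z) − Ā(z − e_μ))` is the average over the fibre of `z` and over `j < L^m` of the fine gradients `n′(A′(x″ − je′) − A′(x″ − (j+1)e′))` (translated fibres + telescoping), each within
`(2(d+1)(L^m − 1) + L^m)·ℓ₂′` of `∇′A′(x′)` when `∇′A′ = n′(A′ − A′(· − e′))` has unit steps `≤ ℓ₂′` ((3.35)'s third member: `ℓ₂′ ≤ r/n′`).  Hence `ω_V = O((d+1)·r/n)` — the η-rate.
* §1 `norm_sub_invCard_smul_sum_le` (an average of points within `B` of `v` is within `B` of `v`);
* §2 ★ `smul_gavgM_sub_shift_eq` (the coarse gradient of block means as a double average of fine gradients), ★★ `norm_fineGrad_sub_coarseGrad_le` (THE GRADIENT FIT);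
* §3 `bDiv_smul_one_sub_cvT₀_exp_eq` (`div_n(n(1 − T))` as a coordinate matrix), ★★ `omegaV_entry_le`, ★★ `omegaV_rows_le` (243's `hωV`), ★★ `omegaV_cols_le` (243's `hωVt`):
  `≤ |ι|·κ_e·(d+1)·(2(2(d+1)(L^m−1) + L^m)ℓ₂′ + 16r(ℓ′ + L^mℓ′))`.

HONEST FRAMING ∕ LIMITS.  Real-analysis bookkeeping; MODEL transporters (site data `e^{A/n}`); NOT [Balaban1985BackgroundPropagators] Lemma 3.3 ∕ Thm 3.4 ∕ Thm 3.14 as printed; NE2⁺ NOT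
PRINTED; N15 of record untouched (DISCHARGED AS CONSUMED, p687738); counts UNMOVED (typed 28∕28 · discharged 8∕27); one finite 𝕋⁴ at fixed ε per index — NOT infinite volume ∕ OS ∕ mass gap ∕ Clay.
-/

noncomputable section

open scoped BigOperators Matrix
open Finset

namespace Summit.QuantumFields.YangMills.BalabanUVNodes.N15.Gluing

open Literature.MathematicalPhysics.QuantumFieldTheory.Balaban1983to89
open Literature.MathematicalPhysics.QuantumFieldTheory.Balaban1983to89.B5Prop11Plancherel (Tor fine unitVec)
open Literature.MathematicalPhysics.QuantumFieldTheory.Balaban1983to89.T4EtaRateCoeffDefect (fibre mem_fibre)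
open Summit.QuantumFields.YangMills.BalabanUVNodes.N15.MatrixSpecies (coordMat basisConst basisConst_nonneg coordMat_sub blockAvgV norm_blockAvgV_le norm_scaledAdDiff_sub_comm_le)
open Summit.QuantumFields.YangMills.BalabanUVNodes.N15.BackgroundLayer (gavgM coordMat_one coordMat_smul coordMat_sum)
open Summit.QuantumFields.YangMills.BalabanUVNodes.N15.CurvedSpecies (conjTranspose_exp_smul_of_conjTranspose abs_coordMat_entry_le)
open Summit.QuantumFields.YangMills.BalabanUVNodes.N15.VectorPiece (kingPr kingPrV bshiftEquiv fibre_conn_kingPrV)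
open Summit.QuantumFields.YangMills.BalabanUVNodes.N15.GenuineSite (card_fibre_kingPrV)
open Summit.QuantumFields.YangMills.BalabanUVNodes.N15.CovLandau (bDiv)

variable {d : ℕ} {L : ℕ} [NeZero L]

/-! ## §1 Averages -/

section Avg

variable {E : Type} [NormedAddCommGroup E] [NormedSpace ℝ E]

/-- an average of points within `B` of `v` is within `B` of `v`. [folklore] -/
theorem norm_sub_invCard_smul_sum_le {α : Type} (S : Finset α) (hS : S.card ≠ 0) (v : E) (w : α → E) {B : ℝ} (h : ∀ s ∈ S, ‖v - w s‖ ≤ B) :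
    ‖v - ((S.card : ℝ))⁻¹ • ∑ s ∈ S, w s‖ ≤ B := by
  have hc : (0 : ℝ) < (S.card : ℝ) := Nat.cast_pos.mpr (Nat.pos_of_ne_zero hS)
  have hrepr : v - ((S.card : ℝ))⁻¹ • ∑ s ∈ S, w s = ((S.card : ℝ))⁻¹ • ∑ s ∈ S, (v - w s) := by
    rw [Finset.sum_sub_distrib, Finset.sum_const, smul_sub, ← Nat.cast_smul_eq_nsmul ℝ, smul_smul, inv_mul_cancel₀ hc.ne', one_smul]
  rw [hrepr, norm_smul, Real.norm_of_nonneg (inv_nonneg.mpr hc.le)]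
  calc ((S.card : ℝ))⁻¹ * ‖∑ s ∈ S, (v - w s)‖ ≤ ((S.card : ℝ))⁻¹ * ∑ s ∈ S, B :=
        mul_le_mul_of_nonneg_left ((norm_sum_le _ _).trans (Finset.sum_le_sum h)) (inv_nonneg.mpr hc.le)
    _ = B := by rw [Finset.sum_const, nsmul_eq_mul, ← mul_assoc, inv_mul_cancel₀ hc.ne', one_mul]

end Avg

/-! ## §2 The coarse gradient of King block means is a double average of fine gradients; the gradient fit -/

section GradFit

variable (M : Fin (d + 1) → ℕ) [∀ μ, NeZero (M μ)] (k m : ℕ) {E : Type} [NormedAddCommGroup E] [NormedSpace ℝ E]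

/-- ★ **THE COARSE GRADIENT OF THE BLOCK MEAN AS A DOUBLE AVERAGE**: `n(Ā_μ′(z, ν) − Ā_μ′(z − e_μ, ν)) = |F|⁻¹ Σ_{x″ ∈ F(z,ν)} (L^m)⁻¹ Σ_{j<L^m} n′(A′_μ′(x″ − je′_μ) − A′_μ′(x″ − je′_μ − e′_μ))`,
`n = L^k`, `n′ = L^mL^k` (translated fibres, n15-c∕233a, + telescoping). [cite: King1986, p.664 (pairing convention); Balaban1985BackgroundPropagators, (3.35) p.396 (shape)] -/
theorem smul_gavgM_sub_shift_eq (A' : Fin (d + 1) → Tor (fine (L ^ m * L ^ k) M) × Fin (d + 1) → E) (μ' μ ν : Fin (d + 1)) (z : Tor (fine (L ^ k) M)) :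
    (((L ^ k : ℕ) : ℝ)) • (gavgM E (Fin (d + 1)) (kingPrV L k m M) A' μ' (z, ν) - gavgM E (Fin (d + 1)) (kingPrV L k m M) A' μ' (z - unitVec (fine (L ^ k) M) μ, ν)) =
      ((((L ^ m) ^ (d + 1) : ℕ) : ℝ))⁻¹ • ∑ x'' ∈ fibre (kingPrV L k m M) (z, ν), ((((L ^ m : ℕ) : ℝ))⁻¹ • ∑ j ∈ Finset.range (L ^ m),
        (((L ^ m * L ^ k : ℕ) : ℝ)) • (A' μ' (x''.1 - j • unitVec (fine (L ^ m * L ^ k) M) μ, x''.2) - A' μ' (x''.1 - j • unitVec (fine (L ^ m * L ^ k) M) μ - unitVec (fine (L ^ m * L ^ k) M) μ, x''.2))) := by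
  classical
  have hc1 := card_fibre_kingPrV (L := L) k m M (z, ν)
  have hc2 := card_fibre_kingPrV (L := L) k m M (z - unitVec (fine (L ^ k) M) μ, ν)
  have hLm0 : (0 : ℝ) < ((L ^ m : ℕ) : ℝ) := by exact_mod_cast pow_pos (Nat.pos_of_ne_zero (NeZero.ne L)) m
  -- the fibre of `(z − e_μ, ν)` is the fibre of `(z, ν)` translated by `−L^m e′_μ`
  set τ : Tor (fine (L ^ m * L ^ k) M) × Fin (d + 1) → Tor (fine (L ^ m * L ^ k) M) × Fin (d + 1) := fun x' => (x'.1 + L ^ m • unitVec (fine (L ^ m * L ^ k) M) μ, x'.2) with hτ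
  have hinj : Set.InjOn τ ↑(fibre (kingPrV L k m M) (z - unitVec (fine (L ^ k) M) μ, ν)) := by
    intro x _ y _ h
    simp only [hτ, Prod.mk.injEq, add_left_inj] at h
    exact Prod.ext h.1 h.2
  have hsum : ∑ x' ∈ fibre (kingPrV L k m M) (z - unitVec (fine (L ^ k) M) μ, ν), A' μ' x' =
      ∑ x'' ∈ fibre (kingPrV L k m M) (z, ν), A' μ' (x''.1 - L ^ m • unitVec (fine (L ^ m * L ^ k) M) μ, x''.2) := by
    rw [← fibre_kingPrV_shift M k m μ ν z, Finset.sum_image hinj]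
    refine Finset.sum_congr rfl fun x _ => ?_
    simp only [hτ, add_sub_cancel_right]
  -- telescoping along `L^m` fine steps, for every point of the fibre
  have key : ∀ x'' : Tor (fine (L ^ m * L ^ k) M) × Fin (d + 1), (((L ^ k : ℕ) : ℝ)) • (A' μ' x'' - A' μ' (x''.1 - L ^ m • unitVec (fine (L ^ m * L ^ k) M) μ, x''.2)) =
      (((L ^ m : ℕ) : ℝ))⁻¹ • ∑ j ∈ Finset.range (L ^ m),
        (((L ^ m * L ^ k : ℕ) : ℝ)) • (A' μ' (x''.1 - j • unitVec (fine (L ^ m * L ^ k) M) μ, x''.2) - A' μ' (x''.1 - j • unitVec (fine (L ^ m * L ^ k) M) μ - unitVec (fine (L ^ m * L ^ k) M) μ, x''.2)) := by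
    intro x''
    have htel := Finset.sum_range_sub' (fun j : ℕ => A' μ' (x''.1 - j • unitVec (fine (L ^ m * L ^ k) M) μ, x''.2)) (L ^ m)
    simp only [zero_smul, sub_zero, Prod.mk.eta] at htel
    rw [← htel, Finset.smul_sum, Finset.smul_sum]
    refine Finset.sum_congr rfl fun j _ => ?_
    rw [smul_smul, Nat.cast_mul, ← mul_assoc, inv_mul_cancel₀ hLm0.ne', one_mul, succ_nsmul, sub_add_eq_sub_sub]
  show (((L ^ k : ℕ) : ℝ)) • (blockAvgV (kingPrV L k m M) (A' μ') (z, ν) - blockAvgV (kingPrV L k m M) (A' μ') (z - unitVec (fine (L ^ k) M) μ, ν)) = _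
  simp only [blockAvgV]
  rw [hc1, hc2, hsum, ← smul_sub, ← Finset.sum_sub_distrib, smul_comm, Finset.smul_sum]
  exact congrArg _ (Finset.sum_congr rfl fun x'' _ => key x'')

/-- ★★ **THE GRADIENT FIT**: if the fine gradient `∇′A′_μ′ := n′(A′_μ′ − A′_μ′(· − e′_μ))` has unit steps `≤ ℓ₂′` in every direction, then
`|∇′A′_μ′(x′, ν) − n(Ā_μ′(pr x′, ν) − Ā_μ′(pr x′ − e_μ, ν))| ≤ (2(d+1)(L^m − 1) + L^m)·ℓ₂′`. [cite: King1986, p.664 (pairing); Balaban1985BackgroundPropagators, (3.35) p.396 (third member: shape)] -/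
theorem norm_fineGrad_sub_coarseGrad_le (A' : Fin (d + 1) → Tor (fine (L ^ m * L ^ k) M) × Fin (d + 1) → E) (μ' μ : Fin (d + 1)) {ℓ₂ : ℝ}
    (hstep2 : ∀ κ (b' : Tor (fine (L ^ m * L ^ k) M) × Fin (d + 1)),
      ‖(fun b : Tor (fine (L ^ m * L ^ k) M) × Fin (d + 1) => (((L ^ m * L ^ k : ℕ) : ℝ)) • (A' μ' b - A' μ' (b.1 - unitVec (fine (L ^ m * L ^ k) M) μ, b.2))) (bshiftEquiv M (L ^ m * L ^ k) κ b') -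
        (fun b : Tor (fine (L ^ m * L ^ k) M) × Fin (d + 1) => (((L ^ m * L ^ k : ℕ) : ℝ)) • (A' μ' b - A' μ' (b.1 - unitVec (fine (L ^ m * L ^ k) M) μ, b.2))) b'‖ ≤ ℓ₂)
    (ν : Fin (d + 1)) (x' : Tor (fine (L ^ m * L ^ k) M)) :
    ‖(((L ^ m * L ^ k : ℕ) : ℝ)) • (A' μ' (x', ν) - A' μ' (x' - unitVec (fine (L ^ m * L ^ k) M) μ, ν)) -
        (((L ^ k : ℕ) : ℝ)) • (gavgM E (Fin (d + 1)) (kingPrV L k m M) A' μ' (kingPr L k m M x', ν) -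
          gavgM E (Fin (d + 1)) (kingPrV L k m M) A' μ' (kingPr L k m M x' - unitVec (fine (L ^ k) M) μ, ν))‖ ≤ ((2 * ((d + 1) * (L ^ m - 1)) + L ^ m : ℕ) : ℝ) * ℓ₂ := by
  classical
  set Fd : Tor (fine (L ^ m * L ^ k) M) × Fin (d + 1) → E := fun b => (((L ^ m * L ^ k : ℕ) : ℝ)) • (A' μ' b - A' μ' (b.1 - unitVec (fine (L ^ m * L ^ k) M) μ, b.2)) with hFd
  have hℓ₂ : 0 ≤ ℓ₂ := (norm_nonneg _).trans (hstep2 0 (x', ν))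
  have hconn := fibre_conn_kingPrV (L := L) (k := k) (m := m) (M := M) Fd ℓ₂ hstep2
  rw [smul_gavgM_sub_shift_eq]
  have hcard : (fibre (kingPrV L k m M) (kingPr L k m M x', ν)).card = (L ^ m) ^ (d + 1) := card_fibre_kingPrV (L := L) k m M _
  have hne : (fibre (kingPrV L k m M) (kingPr L k m M x', ν)).card ≠ 0 := by
    rw [hcard]; exact pow_ne_zero _ (pow_ne_zero _ (NeZero.ne L))
  rw [show ((((L ^ m) ^ (d + 1) : ℕ) : ℝ)) = ((fibre (kingPrV L k m M) (kingPr L k m M x', ν)).card : ℝ) by rw [hcard]]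
  refine norm_sub_invCard_smul_sum_le _ hne _ _ fun x'' hx'' => ?_
  have hx : kingPrV L k m M (x', ν) = kingPrV L k m M x'' := by rw [(mem_fibre _ _ _).1 hx'']; rfl
  rw [show ((((L ^ m : ℕ) : ℝ)))⁻¹ = (((Finset.range (L ^ m)).card : ℝ))⁻¹ by rw [Finset.card_range]]
  refine norm_sub_invCard_smul_sum_le _ (by rw [Finset.card_range]; exact pow_ne_zero _ (NeZero.ne L)) _ _ fun j hj => ?_
  have hjL : j < L ^ m := Finset.mem_range.mp hj
  -- `x′ → x″` inside the fibre, then `j` steps back along `e′_μ`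
  have h1 : ‖Fd (x', ν) - Fd x''‖ ≤ ((2 * ((d + 1) * (L ^ m - 1)) : ℕ) : ℝ) * ℓ₂ := hconn _ _ hx
  have h2 : ‖Fd x'' - Fd (x''.1 - j • unitVec (fine (L ^ m * L ^ k) M) μ, x''.2)‖ ≤ (L ^ m : ℕ) * ℓ₂ := by
    have h := norm_sub_smul_steps_le M Fd (fun κ i => hstep2 κ i) μ (x''.1 - j • unitVec (fine (L ^ m * L ^ k) M) μ, x''.2) j
    simp only [sub_add_cancel, Prod.mk.eta] at h
    refine h.trans (mul_le_mul_of_nonneg_right (by exact_mod_cast hjL.le) hℓ₂)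
  calc ‖Fd (x', ν) - Fd (x''.1 - j • unitVec (fine (L ^ m * L ^ k) M) μ, x''.2)‖
      ≤ ‖Fd (x', ν) - Fd x''‖ + ‖Fd x'' - Fd (x''.1 - j • unitVec (fine (L ^ m * L ^ k) M) μ, x''.2)‖ := norm_sub_le_norm_sub_add_norm_sub _ _ _
    _ ≤ ((2 * ((d + 1) * (L ^ m - 1)) : ℕ) : ℝ) * ℓ₂ + (L ^ m : ℕ) * ℓ₂ := add_le_add h1 h2
    _ = ((2 * ((d + 1) * (L ^ m - 1)) + L ^ m : ℕ) : ℝ) * ℓ₂ := by push_cast; ring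

end GradFit

/-! ## §3 The oscillation letter `ω_V` of the lattice divergence -/

section OmegaV

open scoped Matrix.Norms.L2Operator

variable (M : Fin (d + 1) → ℕ) [∀ μ, NeZero (M μ)] (k m : ℕ) {ι : Type} [Fintype ι] [DecidableEq ι]
  {mm : Type} [Fintype mm] [DecidableEq mm] (e : Matrix mm mm ℂ ≃L[ℝ] (ι → ℝ))

/-- `div_n(n(1 − T))(z) = coordMat e (Σ_μ n·n·(Ad_{e^{A_μ(z)/n}} − Ad_{e^{A_μ(z−e_μ)/n}}))` for an exponential site datum (skewness). [folklore] -/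
theorem bDiv_smul_one_sub_cvT₀_exp_eq (nn : ℕ) [NeZero nn] {A : Fin (d + 1) → Tor (fine nn M) × Fin (d + 1) → Matrix mm mm ℂ} (hAs : ∀ μ p, (A μ p)ᴴ = -A μ p)
    (z : Tor (fine nn M)) :
    bDiv M nn (fun ν x => ((nn : ℕ) : ℝ) • ((1 : Matrix ι ι ℝ) - cvT₀ e (fun μ p => NormedSpace.exp ((((nn : ℕ) : ℝ))⁻¹ • A μ p)) ν x)) z =
      coordMat e (∑ μ : Fin (d + 1), ((nn : ℕ) : ℝ) • (((nn : ℕ) : ℝ) •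
        (ContinuousLinearMap.mulLeftRight ℝ (Matrix mm mm ℂ) (NormedSpace.exp ((((nn : ℕ) : ℝ))⁻¹ • A μ (z, μ))) (NormedSpace.exp (-(((((nn : ℕ) : ℝ))⁻¹ • A μ (z, μ))))) -
          ContinuousLinearMap.mulLeftRight ℝ (Matrix mm mm ℂ) (NormedSpace.exp ((((nn : ℕ) : ℝ))⁻¹ • A μ (z - unitVec (fine nn M) μ, μ)))
            (NormedSpace.exp (-(((((nn : ℕ) : ℝ))⁻¹ • A μ (z - unitVec (fine nn M) μ, μ)))))))) := by
  rw [coordMat_sum]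
  refine Finset.sum_congr rfl fun μ _ => ?_
  rw [coordMat_smul, coordMat_smul, coordMat_sub, ← smul_sub, cvT₀, cvT₀, conjTranspose_exp_smul_of_conjTranspose (hAs μ _), conjTranspose_exp_smul_of_conjTranspose (hAs μ _)]
  congr 2
  abel

/-- ★★ **THE OSCILLATION LETTER `ω_V`, ENTRYWISE**: for the fine field `A′` (skew, `‖A′‖ ≤ r ≤ 1`, unit steps `≤ ℓ′`, fine gradients with unit steps `≤ ℓ₂′`) and its King block mean `Ā`,
`|(div_{n′}(N′)(x′) − div_n(N)(pr x′))_{ij}| ≤ κ_e·(d+1)·(2·(2(d+1)(L^m−1) + L^m)·ℓ₂′ + 16r(ℓ′ + L^mℓ′))`.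
[cite: Balaban1985BackgroundPropagators, (3.35)–(3.37) p.396, (3.52) p.400, Thm 3.14 pp.426–427 (shapes); King1986, p.664 (pairing)] -/
theorem omegaV_entry_le {A' : Fin (d + 1) → Tor (fine (L ^ m * L ^ k) M) × Fin (d + 1) → Matrix mm mm ℂ} (hAs : ∀ μ p, (A' μ p)ᴴ = -A' μ p) {r ℓ' ℓ₂ : ℝ} (hr1 : r ≤ 1)
    (hA : ∀ μ p, ‖A' μ p‖ ≤ r) (hstep : ∀ μ κ b', ‖A' μ (bshiftEquiv M (L ^ m * L ^ k) κ b') - A' μ b'‖ ≤ ℓ')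
    (hstep2 : ∀ μ κ (b' : Tor (fine (L ^ m * L ^ k) M) × Fin (d + 1)),
      ‖(fun b : Tor (fine (L ^ m * L ^ k) M) × Fin (d + 1) => (((L ^ m * L ^ k : ℕ) : ℝ)) • (A' μ b - A' μ (b.1 - unitVec (fine (L ^ m * L ^ k) M) μ, b.2))) (bshiftEquiv M (L ^ m * L ^ k) κ b') -
        (fun b : Tor (fine (L ^ m * L ^ k) M) × Fin (d + 1) => (((L ^ m * L ^ k : ℕ) : ℝ)) • (A' μ b - A' μ (b.1 - unitVec (fine (L ^ m * L ^ k) M) μ, b.2))) b'‖ ≤ ℓ₂)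
    (x' : Tor (fine (L ^ m * L ^ k) M)) (i j : ι) :
    |(bDiv M (L ^ m * L ^ k) (fun ν x => (((L ^ m * L ^ k : ℕ) : ℝ)) • ((1 : Matrix ι ι ℝ) - cvT₀ e (fun μ p => NormedSpace.exp (((((L ^ m * L ^ k : ℕ) : ℝ))⁻¹) • A' μ p)) ν x)) x' -
        bDiv M (L ^ k) (fun ν x => (((L ^ k : ℕ) : ℝ)) • ((1 : Matrix ι ι ℝ) - cvT₀ e (fun μ p => NormedSpace.exp (((((L ^ k : ℕ) : ℝ))⁻¹) • gavgM (Matrix mm mm ℂ) (Fin (d + 1)) (kingPrV L k m M) A' μ p)) ν x)) (kingPr L k m M x')) i j| ≤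
      basisConst e * (((d : ℝ) + 1) * (2 * (((2 * ((d + 1) * (L ^ m - 1)) + L ^ m : ℕ) : ℝ) * ℓ₂) + 16 * r * (ℓ' + (L ^ m : ℕ) * ℓ'))) := by
  have hr0 : 0 ≤ r := (norm_nonneg _).trans (hA 0 (x', 0))
  have hℓ'0 : 0 ≤ ℓ' := (norm_nonneg _).trans (hstep 0 0 (x', 0))
  have hℓ₂0 : 0 ≤ ℓ₂ := (norm_nonneg _).trans (hstep2 0 0 (x', 0))
  have hĀs : ∀ μ p, (gavgM (Matrix mm mm ℂ) (Fin (d + 1)) (kingPrV L k m M) A' μ p)ᴴ = -gavgM (Matrix mm mm ℂ) (Fin (d + 1)) (kingPrV L k m M) A' μ p :=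
    fun μ p => gavgM_conjTranspose_of_skew (kingPrV L k m M) hAs μ p
  have hĀ : ∀ μ p, ‖gavgM (Matrix mm mm ℂ) (Fin (d + 1)) (kingPrV L k m M) A' μ p‖ ≤ r := fun μ p => norm_blockAvgV_le (kingPrV L k m M) hr0 (hA μ) p
  -- the unit-step sizes along `μ` on both grids
  have hℓf : ∀ μ (y : Tor (fine (L ^ m * L ^ k) M)), ‖A' μ (y, μ) - A' μ (y - unitVec (fine (L ^ m * L ^ k) M) μ, μ)‖ ≤ ℓ' := fun μ y => by
    have h := hstep μ μ (y - unitVec (fine (L ^ m * L ^ k) M) μ, μ)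
    simpa [bshiftEquiv] using h
  have hℓc : ∀ μ (z : Tor (fine (L ^ k) M)), ‖gavgM (Matrix mm mm ℂ) (Fin (d + 1)) (kingPrV L k m M) A' μ (z, μ) -
      gavgM (Matrix mm mm ℂ) (Fin (d + 1)) (kingPrV L k m M) A' μ (z - unitVec (fine (L ^ k) M) μ, μ)‖ ≤ (L ^ m : ℕ) * ℓ' :=
    fun μ z => norm_gavgM_sub_shift_le M k m A' hstep μ μ μ z
  rw [bDiv_smul_one_sub_cvT₀_exp_eq M e _ hAs, bDiv_smul_one_sub_cvT₀_exp_eq M e _ hĀs, ← coordMat_sub, ← Finset.sum_sub_distrib]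
  refine (abs_coordMat_entry_le e _ i j).trans (mul_le_mul_of_nonneg_left ?_ (basisConst_nonneg e))
  -- per `μ`
  have hμ : ∀ μ : Fin (d + 1), ‖((L ^ m * L ^ k : ℕ) : ℝ) • ((((L ^ m * L ^ k : ℕ) : ℝ)) •
        (ContinuousLinearMap.mulLeftRight ℝ (Matrix mm mm ℂ) (NormedSpace.exp ((((L ^ m * L ^ k : ℕ) : ℝ))⁻¹ • A' μ (x', μ))) (NormedSpace.exp (-(((((L ^ m * L ^ k : ℕ) : ℝ))⁻¹ • A' μ (x', μ))))) -
          ContinuousLinearMap.mulLeftRight ℝ (Matrix mm mm ℂ) (NormedSpace.exp ((((L ^ m * L ^ k : ℕ) : ℝ))⁻¹ • A' μ (x' - unitVec (fine (L ^ m * L ^ k) M) μ, μ)))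
            (NormedSpace.exp (-(((((L ^ m * L ^ k : ℕ) : ℝ))⁻¹ • A' μ (x' - unitVec (fine (L ^ m * L ^ k) M) μ, μ))))))) -
        ((L ^ k : ℕ) : ℝ) • ((((L ^ k : ℕ) : ℝ)) •
        (ContinuousLinearMap.mulLeftRight ℝ (Matrix mm mm ℂ) (NormedSpace.exp ((((L ^ k : ℕ) : ℝ))⁻¹ • gavgM (Matrix mm mm ℂ) (Fin (d + 1)) (kingPrV L k m M) A' μ (kingPr L k m M x', μ)))
            (NormedSpace.exp (-(((((L ^ k : ℕ) : ℝ))⁻¹ • gavgM (Matrix mm mm ℂ) (Fin (d + 1)) (kingPrV L k m M) A' μ (kingPr L k m M x', μ))))) -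
          ContinuousLinearMap.mulLeftRight ℝ (Matrix mm mm ℂ) (NormedSpace.exp ((((L ^ k : ℕ) : ℝ))⁻¹ • gavgM (Matrix mm mm ℂ) (Fin (d + 1)) (kingPrV L k m M) A' μ (kingPr L k m M x' - unitVec (fine (L ^ k) M) μ, μ)))
            (NormedSpace.exp (-(((((L ^ k : ℕ) : ℝ))⁻¹ • gavgM (Matrix mm mm ℂ) (Fin (d + 1)) (kingPrV L k m M) A' μ (kingPr L k m M x' - unitVec (fine (L ^ k) M) μ, μ)))))))‖ ≤
      2 * (((2 * ((d + 1) * (L ^ m - 1)) + L ^ m : ℕ) : ℝ) * ℓ₂) + 16 * r * (ℓ' + (L ^ m : ℕ) * ℓ') := by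
    intro μ
    have hfit := norm_fineGrad_sub_coarseGrad_le M k m A' μ μ (hstep2 μ) μ x'
    refine ContinuousLinearMap.opNorm_le_bound _ (by positivity) fun X => ?_
    -- abbreviations
    generalize hB₁' : A' μ (x', μ) = B₁' at hfit ⊢
    generalize hB₂' : A' μ (x' - unitVec (fine (L ^ m * L ^ k) M) μ, μ) = B₂' at hfit ⊢
    generalize hB₁ : gavgM (Matrix mm mm ℂ) (Fin (d + 1)) (kingPrV L k m M) A' μ (kingPr L k m M x', μ) = B₁ at hfit ⊢
    generalize hB₂ : gavgM (Matrix mm mm ℂ) (Fin (d + 1)) (kingPrV L k m M) A' μ (kingPr L k m M x' - unitVec (fine (L ^ k) M) μ, μ) = B₂ at hfit ⊢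
    have hb₁' : ‖B₁'‖ ≤ r := hB₁' ▸ hA μ _
    have hb₂' : ‖B₂'‖ ≤ r := hB₂' ▸ hA μ _
    have hb₁ : ‖B₁‖ ≤ r := hB₁ ▸ hĀ μ _
    have hb₂ : ‖B₂‖ ≤ r := hB₂ ▸ hĀ μ _
    have hl' : ‖B₁' - B₂'‖ ≤ ℓ' := by rw [← hB₁', ← hB₂']; exact hℓf μ x'
    have hl : ‖B₁ - B₂‖ ≤ (L ^ m : ℕ) * ℓ' := by rw [← hB₁, ← hB₂]; exact hℓc μ (kingPr L k m M x')
    have hf := norm_scaledAdDiff_sub_comm_le (L ^ m * L ^ k) hb₁' hb₂' hr1 X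
    have hc := norm_scaledAdDiff_sub_comm_le (L ^ k) hb₁ hb₂ hr1 X
    generalize NormedSpace.exp ((((L ^ m * L ^ k : ℕ) : ℝ))⁻¹ • B₁') = U₁ at hf ⊢
    generalize NormedSpace.exp (-(((((L ^ m * L ^ k : ℕ) : ℝ))⁻¹ • B₁'))) = V₁ at hf ⊢
    generalize NormedSpace.exp ((((L ^ m * L ^ k : ℕ) : ℝ))⁻¹ • B₂') = U₂ at hf ⊢
    generalize NormedSpace.exp (-(((((L ^ m * L ^ k : ℕ) : ℝ))⁻¹ • B₂'))) = V₂ at hf ⊢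
    generalize NormedSpace.exp ((((L ^ k : ℕ) : ℝ))⁻¹ • B₁) = U₃ at hc ⊢
    generalize NormedSpace.exp (-(((((L ^ k : ℕ) : ℝ))⁻¹ • B₁))) = V₃ at hc ⊢
    generalize NormedSpace.exp ((((L ^ k : ℕ) : ℝ))⁻¹ • B₂) = U₄ at hc ⊢
    generalize NormedSpace.exp (-(((((L ^ k : ℕ) : ℝ))⁻¹ • B₂))) = V₄ at hc ⊢
    generalize hD' : (((L ^ m * L ^ k : ℕ) : ℝ)) • (B₁' - B₂') = D' at hf hfit ⊢
    generalize hD : (((L ^ k : ℕ) : ℝ)) • (B₁ - B₂) = D at hc hfit ⊢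
    have e1 : ((((L ^ m * L ^ k : ℕ) : ℝ)) • ((((L ^ m * L ^ k : ℕ) : ℝ)) • (ContinuousLinearMap.mulLeftRight ℝ (Matrix mm mm ℂ) U₁ V₁ - ContinuousLinearMap.mulLeftRight ℝ (Matrix mm mm ℂ) U₂ V₂)) - (((L ^ k : ℕ) : ℝ)) • ((((L ^ k : ℕ) : ℝ)) • (ContinuousLinearMap.mulLeftRight ℝ (Matrix mm mm ℂ) U₃ V₃ - ContinuousLinearMap.mulLeftRight ℝ (Matrix mm mm ℂ) U₄ V₄))) X =
      ((((L ^ m * L ^ k : ℕ) : ℝ)) • ((((L ^ m * L ^ k : ℕ) : ℝ)) • (U₁ * X * V₁ - U₂ * X * V₂)) - (D' * X - X * D')) - ((((L ^ k : ℕ) : ℝ)) • ((((L ^ k : ℕ) : ℝ)) • (U₃ * X * V₃ - U₄ * X * V₄)) - (D * X - X * D)) + ((D' - D) * X - X * (D' - D)) := by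
      simp only [sub_apply, smul_apply, ContinuousLinearMap.mulLeftRight_apply, smul_sub, sub_mul, mul_sub]
      abel
    rw [e1]
    have hX := norm_nonneg X
    calc ‖((((L ^ m * L ^ k : ℕ) : ℝ)) • ((((L ^ m * L ^ k : ℕ) : ℝ)) • (U₁ * X * V₁ - U₂ * X * V₂)) - (D' * X - X * D')) - ((((L ^ k : ℕ) : ℝ)) • ((((L ^ k : ℕ) : ℝ)) • (U₃ * X * V₃ - U₄ * X * V₄)) - (D * X - X * D)) + ((D' - D) * X - X * (D' - D))‖
        ≤ 16 * r * ‖B₁' - B₂'‖ * ‖X‖ + 16 * r * ‖B₁ - B₂‖ * ‖X‖ + (‖D' - D‖ * ‖X‖ + ‖X‖ * ‖D' - D‖) :=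
          (norm_add_le _ _).trans (add_le_add ((norm_sub_le _ _).trans (add_le_add hf hc)) ((norm_sub_le _ _).trans (add_le_add (norm_mul_le _ _) (norm_mul_le _ _))))
      _ ≤ 16 * r * ℓ' * ‖X‖ + 16 * r * ((L ^ m : ℕ) * ℓ') * ‖X‖ +
          (((((2 * ((d + 1) * (L ^ m - 1)) + L ^ m : ℕ) : ℝ)) * ℓ₂) * ‖X‖ + ‖X‖ * ((((2 * ((d + 1) * (L ^ m - 1)) + L ^ m : ℕ) : ℝ)) * ℓ₂)) := by
          gcongr
      _ = (2 * (((2 * ((d + 1) * (L ^ m - 1)) + L ^ m : ℕ) : ℝ) * ℓ₂) + 16 * r * (ℓ' + (L ^ m : ℕ) * ℓ')) * ‖X‖ := by ring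
  refine (norm_sum_le _ _).trans ((Finset.sum_le_sum fun μ _ => hμ μ).trans (le_of_eq ?_))
  rw [Finset.sum_const, Finset.card_univ, Fintype.card_fin, nsmul_eq_mul]; push_cast; ring

/-- ★★ **ROWS OF `ω_V`** (243's `hωV`). [cite: Balaban1985BackgroundPropagators, (3.35) p.396, (3.52) p.400, Thm 3.14 pp.426–427 (shapes)] -/
theorem omegaV_rows_le {A' : Fin (d + 1) → Tor (fine (L ^ m * L ^ k) M) × Fin (d + 1) → Matrix mm mm ℂ} (hAs : ∀ μ p, (A' μ p)ᴴ = -A' μ p) {r ℓ' ℓ₂ : ℝ} (hr1 : r ≤ 1)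
    (hA : ∀ μ p, ‖A' μ p‖ ≤ r) (hstep : ∀ μ κ b', ‖A' μ (bshiftEquiv M (L ^ m * L ^ k) κ b') - A' μ b'‖ ≤ ℓ')
    (hstep2 : ∀ μ κ (b' : Tor (fine (L ^ m * L ^ k) M) × Fin (d + 1)),
      ‖(fun b : Tor (fine (L ^ m * L ^ k) M) × Fin (d + 1) => (((L ^ m * L ^ k : ℕ) : ℝ)) • (A' μ b - A' μ (b.1 - unitVec (fine (L ^ m * L ^ k) M) μ, b.2))) (bshiftEquiv M (L ^ m * L ^ k) κ b') -
        (fun b : Tor (fine (L ^ m * L ^ k) M) × Fin (d + 1) => (((L ^ m * L ^ k : ℕ) : ℝ)) • (A' μ b - A' μ (b.1 - unitVec (fine (L ^ m * L ^ k) M) μ, b.2))) b'‖ ≤ ℓ₂)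
    (x' : Tor (fine (L ^ m * L ^ k) M)) (i : ι) :
    ∑ j, |(bDiv M (L ^ m * L ^ k) (fun ν x => (((L ^ m * L ^ k : ℕ) : ℝ)) • ((1 : Matrix ι ι ℝ) - cvT₀ e (fun μ p => NormedSpace.exp (((((L ^ m * L ^ k : ℕ) : ℝ))⁻¹) • A' μ p)) ν x)) x' -
        bDiv M (L ^ k) (fun ν x => (((L ^ k : ℕ) : ℝ)) • ((1 : Matrix ι ι ℝ) - cvT₀ e (fun μ p => NormedSpace.exp (((((L ^ k : ℕ) : ℝ))⁻¹) • gavgM (Matrix mm mm ℂ) (Fin (d + 1)) (kingPrV L k m M) A' μ p)) ν x)) (kingPr L k m M x')) i j| ≤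
      Fintype.card ι * (basisConst e * (((d : ℝ) + 1) * (2 * (((2 * ((d + 1) * (L ^ m - 1)) + L ^ m : ℕ) : ℝ) * ℓ₂) + 16 * r * (ℓ' + (L ^ m : ℕ) * ℓ')))) := by
  calc _ ≤ ∑ _j : ι, basisConst e * (((d : ℝ) + 1) * (2 * (((2 * ((d + 1) * (L ^ m - 1)) + L ^ m : ℕ) : ℝ) * ℓ₂) + 16 * r * (ℓ' + (L ^ m : ℕ) * ℓ'))) :=
        Finset.sum_le_sum fun j _ => omegaV_entry_le M k m e hAs hr1 hA hstep hstep2 x' i j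
    _ = _ := by rw [Finset.sum_const, Finset.card_univ, nsmul_eq_mul]

/-- ★★ **COLUMNS OF `ω_V`** (243's `hωVt`, the rows of the transposes). [cite: Balaban1985BackgroundPropagators, (3.35) p.396, (3.52) p.400, Thm 3.14 pp.426–427 (shapes)] -/
theorem omegaV_cols_le {A' : Fin (d + 1) → Tor (fine (L ^ m * L ^ k) M) × Fin (d + 1) → Matrix mm mm ℂ} (hAs : ∀ μ p, (A' μ p)ᴴ = -A' μ p) {r ℓ' ℓ₂ : ℝ} (hr1 : r ≤ 1)
    (hA : ∀ μ p, ‖A' μ p‖ ≤ r) (hstep : ∀ μ κ b', ‖A' μ (bshiftEquiv M (L ^ m * L ^ k) κ b') - A' μ b'‖ ≤ ℓ')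
    (hstep2 : ∀ μ κ (b' : Tor (fine (L ^ m * L ^ k) M) × Fin (d + 1)),
      ‖(fun b : Tor (fine (L ^ m * L ^ k) M) × Fin (d + 1) => (((L ^ m * L ^ k : ℕ) : ℝ)) • (A' μ b - A' μ (b.1 - unitVec (fine (L ^ m * L ^ k) M) μ, b.2))) (bshiftEquiv M (L ^ m * L ^ k) κ b') -
        (fun b : Tor (fine (L ^ m * L ^ k) M) × Fin (d + 1) => (((L ^ m * L ^ k : ℕ) : ℝ)) • (A' μ b - A' μ (b.1 - unitVec (fine (L ^ m * L ^ k) M) μ, b.2))) b'‖ ≤ ℓ₂)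
    (x' : Tor (fine (L ^ m * L ^ k) M)) (i : ι) :
    ∑ j, |((fun z => (bDiv M (L ^ m * L ^ k) (fun ν x => (((L ^ m * L ^ k : ℕ) : ℝ)) • ((1 : Matrix ι ι ℝ) - cvT₀ e (fun μ p => NormedSpace.exp (((((L ^ m * L ^ k : ℕ) : ℝ))⁻¹) • A' μ p)) ν x)) z)ᵀ) x' -
        (fun z => (bDiv M (L ^ k) (fun ν x => (((L ^ k : ℕ) : ℝ)) • ((1 : Matrix ι ι ℝ) - cvT₀ e (fun μ p => NormedSpace.exp (((((L ^ k : ℕ) : ℝ))⁻¹) • gavgM (Matrix mm mm ℂ) (Fin (d + 1)) (kingPrV L k m M) A' μ p)) ν x)) z)ᵀ) (kingPr L k m M x')) i j| ≤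
      Fintype.card ι * (basisConst e * (((d : ℝ) + 1) * (2 * (((2 * ((d + 1) * (L ^ m - 1)) + L ^ m : ℕ) : ℝ) * ℓ₂) + 16 * r * (ℓ' + (L ^ m : ℕ) * ℓ')))) := by
  calc _ ≤ ∑ _j : ι, basisConst e * (((d : ℝ) + 1) * (2 * (((2 * ((d + 1) * (L ^ m - 1)) + L ^ m : ℕ) : ℝ) * ℓ₂) + 16 * r * (ℓ' + (L ^ m : ℕ) * ℓ'))) :=
        Finset.sum_le_sum fun j _ => by
          rw [← Matrix.transpose_sub, Matrix.transpose_apply]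
          exact omegaV_entry_le M k m e hAs hr1 hA hstep hstep2 x' j i
    _ = _ := by rw [Finset.sum_const, Finset.card_univ, nsmul_eq_mul]

end OmegaV

end Summit.QuantumFields.YangMills.BalabanUVNodes.N15.Gluing

end
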